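import Literature.NumberTheory.EllipticCurves.FunctionFieldEllipticL
import Literature.NumberTheory.EllipticCurves.FunctionFieldUnramified
import Literature.NumberTheory.EllipticCurves.FunctionFieldEllipticLCompletionProofs
import Literature.NumberTheory.EllipticCurves.FunctionFieldPlacesFiniteResidueFieldProofs
import Literature.NumberTheory.EllipticCurves.TamagawaProofs
import Literature.NumberTheory.EllipticCurves.TamagawaFiniteIndexProofs
import Mathlib.Topology.Algebra.Valued.LocallyCompact
import HarnessLib

/-!
# Elliptic curves over global function fields — the Tamagawa product is a finite product of
# positive integers

Discharges of the two named facts of `Literature.NumberTheory.EllipticCurves.FunctionFieldEllipticL`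
(namespace `Literature.NumberTheory.EllipticCurves.FunctionField`) about
`tamagawaProduct W = ∏ᶠ_v c_v`, `c_v = [E(F_v) : E₀(F_v)]`
(`(W.baseChange v.Completion).localTamagawaNumber v.CompletionIntegers`), for an elliptic curve `W`
over a global function field `F / 𝔽_q(T)`:

* `mulSupport_localTamagawaNumber_finite_holds` — only finitely many places have `c_v ≠ 1`:
  `c_v = 1` at every place of good reduction (Silverman, *AEC* VII.2, remark after Prop. 2.1: the
  reduction is nonsingular, so `E₀(F_v) = E(F_v)`; the tree's
  `WeierstrassCurve.localTamagawaNumber_eq_one_of_hasGoodReduction_holds` over the complete discrete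
  valuation ring `O_{F_v}`) and the set of bad places is finite (Silverman VIII.1 Remark 1.3; the
  tree's `finite_badPlaces`, from Stichtenoth Cor. I.3.4).
* `tamagawaProduct_pos_holds` — `0 < ∏ᶠ_v c_v`: every factor is a finite index (Kodaira–Néron,
  Silverman Cor. VII.6.2; the tree's `WeierstrassCurve.localTamagawaNumber_ne_zero_of_compactSpace`,
  which needs `O_{F_v}` compact), and a `finprod` of positive naturals is positive
  (`finprod_induction`, as in the number-field discharge `WeierstrassCurve.tamagawaProduct_pos_holds`).

The one local input not yet in the tree for function fields is the compactness of `O_{F_v}`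
(`compactSpace_completionIntegers`): `O_{F_v} = 𝒪[F_v]` is complete (closed in the complete field
`F_v`), a discrete valuation ring, and its residue field is that of `O_v`
(`residueFieldCompletionEquiv`, Serre *Local Fields* II §1), which is finite for a place of a
global function field (`finite_residueField_holds`, Stichtenoth Prop. I.1.15); Mathlib's criterion
`Valued.integer.compactSpace_iff_completeSpace_and_isDiscreteValuationRing_and_finite_residueField`
then applies — verbatim the argument of `Literature.NumberTheory.Automorphic.compactSpace_integer_adicCompletion`
(number fields; Weil *BNT* Ch. I §4 Thm. 6: a complete discretely valued field with finite residue
field is locally compact with compact valuation ring).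

As for the other `_holds` theorems of this family, the finite constant field `𝔽_q` and the
function-field structure `[FunctionField Fq F]`, which the bodies of the `def`s do not mention, are
binders of the theorems (design note of `FunctionFieldPlaces` / `FunctionFieldEllipticL`).

## References

* [SilvermanAEC2009] J. H. Silverman, *The Arithmetic of Elliptic Curves*, GTM 106, 2nd ed. 2009,
  §VII.2 (remark after Prop. 2.1), Thm. VII.6.1 and Cor. VII.6.2 (Kodaira–Néron: `E(K)/E₀(K)` is
  finite), §VIII.1 Remark 1.3 (finitely many bad places).
* [WeilBNT1967] A. Weil, *Basic Number Theory*, 1967, Ch. I §4 Thm. 6 (compact valuation rings of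
  `p`-fields), Ch. III §1 (completions of an `A`-field at its places are `p`-fields — for
  `A`-fields of characteristic `p` as well).
* [Stichtenoth2009] H. Stichtenoth, *Algebraic Function Fields and Codes*, GTM 254, 2nd ed. 2009,
  Prop. I.1.15 (residue fields of places are finite over the constant field), Cor. I.3.4.
* [Tate1966Bourbaki] J. Tate, *On the conjectures of Birch and Swinnerton-Dyer and a geometric
  analog*, Sém. Bourbaki 306 (1966), §1 (the Tamagawa factors `c_v`).
-/

noncomputable section

namespace Literature.NumberTheory.EllipticCurves.FunctionField

open scoped Polynomial Valued WithZero
open IsDedekindDomain IsLocalRing WeierstrassCurve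

variable (Fq : Type) [Field Fq] [Fintype Fq] {F : Type} [Field F]
variable [Algebra Fq[X] F] [Algebra (RatFunc Fq) F] [IsScalarTower Fq[X] (RatFunc Fq) F]
variable [FunctionField Fq F]

include Fq in
/-- **`O_{F_v}` is compact** for every place `v` of a global function field `F / 𝔽_q(T)`: the
valuation ring `𝒪[F_v] = v.CompletionIntegers` of the completion is complete, a discrete valuation
ring, and has finite residue field (`= κ(O_v)` by `residueFieldCompletionEquiv`, finite by
`Place.finite_residueField_holds`), so — the discrete valuation of `F_v` being of rank one
(`Valuation.IsRankOneDiscrete.rankOne`, base `2`, as in `FunctionFieldGoodReductionInertia`) — Mathlib's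
criterion
`Valued.integer.compactSpace_iff_completeSpace_and_isDiscreteValuationRing_and_finite_residueField`
applies (Weil, *BNT* Ch. I §4 Thm. 6 with Ch. III §1; the number-field twin is
`Literature.NumberTheory.Automorphic.compactSpace_adicCompletionIntegers'`).
[cite: WeilBNT1967, Ch. I §4 Thm. 6 and Ch. III §1] -/
theorem compactSpace_completionIntegers (v : Place F) : CompactSpace v.CompletionIntegers := by
  haveI : Finite (ResidueField v.1) := Place.finite_residueField_holds Fq v
  letI : (Valued.v : Valuation v.Completion ℤᵐ⁰).RankOne :=
    Valuation.IsRankOneDiscrete.rankOne _ one_lt_two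
  haveI hfin : Finite (ResidueField v.CompletionIntegers) :=
    Finite.of_equiv _ (residueFieldCompletionEquiv v).toEquiv
  haveI : IsDiscreteValuationRing 𝒪[v.Completion] :=
    inferInstanceAs (IsDiscreteValuationRing v.CompletionIntegers)
  haveI : CompleteSpace 𝒪[v.Completion] :=
    completeSpace_coe_iff_isComplete.2 (Valued.isClosed_integer v.Completion).isComplete
  haveI : Finite 𝓀[v.Completion] := hfin
  exact Valued.integer.compactSpace_iff_completeSpace_and_isDiscreteValuationRing_and_finite_residueField.2
    ⟨‹_›, ‹_›, ‹_›⟩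

variable (W : WeierstrassCurve F)

include Fq in
/-- **Discharge** of `mulSupport_localTamagawaNumber_finite`: for an elliptic curve `W` over a
global function field, `c_v = [E(F_v) : E₀(F_v)] ≠ 1` for only finitely many places `v` — the
multiplicative support of `v ↦ c_v` lies in the finite set `badPlaces W` (Silverman VIII.1 Remark
1.3, `finite_badPlaces`), because at a place of good reduction the minimal model over `O_{F_v}` has
nonsingular reduction and `c_v = 1` (Silverman VII.2, remark after Prop. 2.1;
`WeierstrassCurve.localTamagawaNumber_eq_one_of_hasGoodReduction_holds`).
[cite: SilvermanAEC2009, VII.2 (remark after Prop. 2.1) and VIII.1 Remark 1.3] -/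
theorem mulSupport_localTamagawaNumber_finite_holds :
    mulSupport_localTamagawaNumber_finite W := by
  intro hE
  refine (finite_badPlaces Fq W).subset fun v hv => ?_
  rw [mem_badPlaces_iff]
  intro hgood
  refine hv ?_
  haveI : ((W.baseChange v.Completion).minimal v.CompletionIntegers).HasGoodReduction
      v.CompletionIntegers := hgood
  exact (W.baseChange v.Completion).localTamagawaNumber_eq_one_of_hasGoodReduction_holds
    v.CompletionIntegers

include Fq in
/-- **Discharge** of `tamagawaProduct_pos`: the Tamagawa product `∏ᶠ_v c_v` of an elliptic curve
over a global function field is a positive integer — every factor `c_v = [E(F_v) : E₀(F_v)]` is a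
finite index (Kodaira–Néron, Silverman Cor. VII.6.2; Tate 1966 §1), i.e. nonzero
(`WeierstrassCurve.localTamagawaNumber_ne_zero_of_compactSpace`, `O_{F_v}` being compact by
`compactSpace_completionIntegers`), and `finprod_induction` on positivity.
[cite: SilvermanAEC2009, Cor. VII.6.2] [cite: Tate1966Bourbaki, §1] -/
theorem tamagawaProduct_pos_holds : tamagawaProduct_pos W := by
  intro hE
  refine finprod_induction (fun n : ℕ => 0 < n) Nat.one_pos (fun _ _ => Nat.mul_pos) fun v => ?_
  haveI := compactSpace_completionIntegers Fq v
  haveI : (W.baseChange v.Completion).IsElliptic := by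
    rw [WeierstrassCurve.baseChange]; infer_instance
  exact Nat.pos_of_ne_zero
    (WeierstrassCurve.localTamagawaNumber_ne_zero_of_compactSpace v.spectrum
      (W.baseChange v.Completion))

end Literature.NumberTheory.EllipticCurves.FunctionField

end
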